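import Mathlib
import HarnessLib
import Summits.BirchSwinnertonDyer.BirchSwinnertonDyer.Theses.ManinLocalTwoThree
import Summits.BirchSwinnertonDyer.BirchSwinnertonDyer.Theorems.ManinLocalTwoThreeOddUntwistReductions

/-!
# Lines/dyadic-twist v3b (RESHAPE CANDIDATE with TWO genuine stubs, seat bsd-line-manin23-p2, per the
# planner-of-record's 23:32Z remark) — crux `ManinOddAtFour` (C2, stmt-BirchSwinnertonDyer-22967)

The globally-twist-minimal core H₂ (the single stub of `dyadic_twist_v3_candidate.lean`) split by the
conductor exponent at `2`: TAME (`4 ∥ N`: `f₂ = 2`, tame inertia of order `3`, Kodaira IV / IV*; census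
`e₂ = 3`) versus WILD (`8 ∣ N`: `f₂ ∈ {3,…,8}`, `e₂ ∈ {4, 6, 8, 24}`). Both stubs keep the by-name fact
binders and the two untwist exclusions; the composition is the landed
`Theorems.maninLocalTwoThree_maninOddAtFour_of_oddUntwistMinimal` after a case split on `2³ ∣ N`.
Sizes (N < 5·10⁵; p1's census H2H3-census-globally-twist-minimal-p1.md): H₂ = 487 948 optimal classes;
of the 168 649 classes with v₂(N) = 2 (all dyadically twist-minimal, AUTOTYPE23) the globally minimal ones
form the tame stub's range; the rest of H₂ is the wild stub's. OPEN, both. Not registered by this seat.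
-/

set_option autoImplicit false
set_option linter.dupNamespace false

noncomputable section

open WeierstrassCurve Literature.NumberTheory.EllipticCurves
  Literature.NumberTheory.EllipticCurves.ModularForms

namespace Summit.BirchSwinnertonDyer.BirchSwinnertonDyer.Cruxes.ManinOddAtFour.DyadicTwistV3b

/-- STUB 1 (TAME CORE AT `2`: `4 ∥ N`, globally twist-minimal; open). -/
theorem stub_globallyTwistMinimalAtTwo_tame :
    Literature.NumberTheory.EllipticCurves.ModularForms.mazur_not_dvd_maninConstant_of_odd →
    Literature.NumberTheory.EllipticCurves.ModularForms.abbesUllmo_not_dvd_maninConstant_of_not_dvd_level →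
    Literature.NumberTheory.EllipticCurves.ModularForms.cesnavicius_not_two_dvd_maninConstant_of_two_dvd_level →
    Literature.NumberTheory.EllipticCurves.ModularForms.exists_isNewformOf →
    ∀ (W : WeierstrassCurve ℚ) [W.IsElliptic] [W.IsGloballyMinimal] {N : ℕ} [NeZero N]
      (D : ModularParametrizationData W N),
      (∀ z ∈ D.L.lattice, ∃ w ∈ periodLattice D.f, z = D.c * w) → 2 ^ 2 ∣ N →
      ¬ (∃ (W' : WeierstrassCurve ℚ) (d : ℤ), W'.IsElliptic ∧ W'.IsGloballyMinimal ∧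
        (d = -1 ∨ d = 2 ∨ d = -2) ∧ IsIsogenous W (W'.quadraticTwist (d : ℚ)) ∧
        ¬ 2 ^ 2 ∣ W'.conductorNorm ℤ) →
      ¬ (∃ (W' : WeierstrassCurve ℚ) (q : ℕ), W'.IsElliptic ∧ W'.IsGloballyMinimal ∧
        q.Prime ∧ q ≠ 2 ∧ q ^ 2 ∣ N ∧
        IsIsogenous W (W'.quadraticTwist (((-1 : ℤ) ^ (q / 2) * q : ℤ) : ℚ)) ∧
        ¬ q ^ 2 ∣ W'.conductorNorm ℤ) →
      ¬ 2 ^ 3 ∣ N →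
      ¬ (2 : ℤ) ∣ D.maninConstant := by
  sorry

/-- STUB 2 (WILD CORE AT `2`: `8 ∣ N`, globally twist-minimal; open). -/
theorem stub_globallyTwistMinimalAtTwo_wild :
    Literature.NumberTheory.EllipticCurves.ModularForms.mazur_not_dvd_maninConstant_of_odd →
    Literature.NumberTheory.EllipticCurves.ModularForms.abbesUllmo_not_dvd_maninConstant_of_not_dvd_level →
    Literature.NumberTheory.EllipticCurves.ModularForms.cesnavicius_not_two_dvd_maninConstant_of_two_dvd_level →
    Literature.NumberTheory.EllipticCurves.ModularForms.exists_isNewformOf →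
    ∀ (W : WeierstrassCurve ℚ) [W.IsElliptic] [W.IsGloballyMinimal] {N : ℕ} [NeZero N]
      (D : ModularParametrizationData W N),
      (∀ z ∈ D.L.lattice, ∃ w ∈ periodLattice D.f, z = D.c * w) → 2 ^ 2 ∣ N →
      ¬ (∃ (W' : WeierstrassCurve ℚ) (d : ℤ), W'.IsElliptic ∧ W'.IsGloballyMinimal ∧
        (d = -1 ∨ d = 2 ∨ d = -2) ∧ IsIsogenous W (W'.quadraticTwist (d : ℚ)) ∧
        ¬ 2 ^ 2 ∣ W'.conductorNorm ℤ) →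
      ¬ (∃ (W' : WeierstrassCurve ℚ) (q : ℕ), W'.IsElliptic ∧ W'.IsGloballyMinimal ∧
        q.Prime ∧ q ≠ 2 ∧ q ^ 2 ∣ N ∧
        IsIsogenous W (W'.quadraticTwist (((-1 : ℤ) ^ (q / 2) * q : ℤ) : ℚ)) ∧
        ¬ q ^ 2 ∣ W'.conductorNorm ℤ) →
      2 ^ 3 ∣ N →
      ¬ (2 : ℤ) ∣ D.maninConstant := by
  sorry

/-- COMPOSITION (no sorry): the two stubs give the crux BY NAME through the landed reductions. -/
theorem ManinOddAtFour_of :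
    Summit.BirchSwinnertonDyer.BirchSwinnertonDyer.Theses.ManinLocalTwoThree.ManinOddAtFour :=
  Summit.BirchSwinnertonDyer.BirchSwinnertonDyer.Theorems.maninLocalTwoThree_maninOddAtFour_of_oddUntwistMinimal
    fun hM hAU hC hnf W _ _ N _ D hopt h4 hmin hodd ↦ by
      by_cases h8 : 2 ^ 3 ∣ N
      · exact stub_globallyTwistMinimalAtTwo_wild hM hAU hC hnf W D hopt h4 hmin hodd h8
      · exact stub_globallyTwistMinimalAtTwo_tame hM hAU hC hnf W D hopt h4 hmin hodd h8

end Summit.BirchSwinnertonDyer.BirchSwinnertonDyer.Cruxes.ManinOddAtFour.DyadicTwistV3b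

end
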